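import Summits.AtomisticToContinuum.Crystallization.Theorems.HullExactificationCascadeZeroDefectDensitySoftDegreeLeFour
import Summits.AtomisticToContinuum.Crystallization.Theorems.HullExactificationCascadeZeroDefectDensityCensusCore
import Summits.AtomisticToContinuum.Crystallization.Theorems.HullExactificationCascadeZeroDefectDensityCensusContain
import Summits.AtomisticToContinuum.Crystallization.Theorems.HullExactificationCascadeZeroDefectDensityCensusCert
import Summits.AtomisticToContinuum.Crystallization.Theorems.HullExactificationCascadeZeroDefectDensityCensusFrame
import Summits.AtomisticToContinuum.Crystallization.Theorems.HullExactificationCascadeZeroDefectDensityLocalStructure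
import Summits.AtomisticToContinuum.Crystallization.Theorems.HullExactificationCascadeZeroDefectDensityCombClassification
import HarnessLib

/-!
# The one-shell effective local Hales kernel at tolerance `1/4000`, gap `7/5` — composition from its four stubs
# (route `HullExactificationCascade`, crux `ZeroDefectDensity`, stmt-AtomisticToContinuum-12086; line `birth`, lead c5)

`kernel_of_stubs75`: soft Lemma 7 (`stub_softDegreeLeFour`) → the Voronoi census (`stub_voronoiCensus`) → the local
rotation structure (`stub_localStructure`) → the combinatorial classification (`stub_combClassification`) → for every
`u ∈ S ⊆ ℝ³` all of whose points within `1 + 1/4000` are `1/4000`-softly twelve-kissed with gap `7/5`, the soft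
contact graph on the soft shell of `u` is isomorphic to the fcc or to the hcp pattern contact graph (phrased with the
`1/400` thresholds that the two-shell lemmas of the line consume; under the gap the two soft shells coincide).
The four hypotheses are displayed verbatim as the registered stub signatures; this file is their kernel-checked glue
(Set/`ncard` → `Fin 12` extraction, transport of the pattern bijection).  Mathlib only.
-/

noncomputable section

namespace Summit.AtomisticToContinuum.Crystallization.Theorems.ZeroDefectDensityBirth

/-- **Kernel composition (PROVED).**  `K1-sig → K2-sig → K3-sig → K4-sig →` (one-shell effective local
Hales at tolerance `1/4000`, gap `7/5`, conclusion phrased with the `1/400` thresholds): the twelve soft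
neighbours of `u` are indexed by `Fin 12` (`ncard = 12`; the `1/400`- and `1/4000`-soft shells of `u`
coincide under the gap), the radial window comes from the kissedness of `u`, the pairwise dichotomy from
the kissedness of each neighbour; K1–K3 produce the rotation data, K4 the pattern bijection, which is
transported back along the indexing equivalence. [folklore] -/
theorem kernel_of_stubs75 : (∀ (u : EuclideanSpace ℝ (Fin 3)) (p : Fin 12 → EuclideanSpace ℝ (Fin 3)), (∀ i : Fin 12, 1 - 1 / 4000 ≤ dist u (p i) ∧ dist u (p i) ≤ 1 + 1 / 4000) → (∀ i j : Fin 12, i ≠ j → 1 - 1 / 4000 ≤ dist (p i) (p j) ∧ (dist (p i) (p j) ≤ 1 + 1 / 4000 ∨ 7 / 5 ≤ dist (p i) (p j))) → ∀ i : Fin 12, {j : Fin 12 | j ≠ i ∧ dist (p i) (p j) ≤ 1 + 1 / 4000}.ncard ≤ 4) → (∀ (u : EuclideanSpace ℝ (Fin 3)) (p : Fin 12 → EuclideanSpace ℝ (Fin 3)), (∀ i : Fin 12, 1 - 1 / 4000 ≤ dist u (p i) ∧ dist u (p i) ≤ 1 + 1 / 4000) → (∀ i j : Fin 12, i ≠ j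 → 1 - 1 / 4000 ≤ dist (p i) (p j) ∧ (dist (p i) (p j) ≤ 1 + 1 / 4000 ∨ 7 / 5 ≤ dist (p i) (p j))) → (∀ i : Fin 12, {j : Fin 12 | j ≠ i ∧ dist (p i) (p j) ≤ 1 + 1 / 4000}.ncard ≤ 4) → ∀ i : Fin 12, {j : Fin 12 | j ≠ i ∧ dist (p i) (p j) ≤ 1 + 1 / 4000}.ncard = 4 ∧ {q : Fin 12 × Fin 12 | q.1 < q.2 ∧ q.1 ≠ i ∧ q.2 ≠ i ∧ dist (p i) (p q.1) ≤ 1 + 1 / 4000 ∧ dist (p i) (p q.2) ≤ 1 + 1 / 4000 ∧ dist (p q.1) (p q.2) ≤ 1 + 1 / 4000}.ncard = 2) → (∀ (u : EuclideanSpace ℝ (Fin 3)) (p : Fin 12 → EuclideanSpace ℝ (Fin 3)), (∀ i : Fin 12, 1 - 1 / 4000 ≤ dist u (p i) ∧ dist u (p i) ≤ 1 + 1 / 4000) → (∀ i j : Fin 12, i ≠ j → 1 - 1 / 4000 ≤ dist (p i) (p j) ∧ (dist (p i) (p j) ≤ 1 + 1 / 4000 ∨ 7 / 5 ≤ dist (p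 i) (p j))) → (∀ i : Fin 12, {j : Fin 12 | j ≠ i ∧ dist (p i) (p j) ≤ 1 + 1 / 4000}.ncard = 4 ∧ {q : Fin 12 × Fin 12 | q.1 < q.2 ∧ q.1 ≠ i ∧ q.2 ≠ i ∧ dist (p i) (p q.1) ≤ 1 + 1 / 4000 ∧ dist (p i) (p q.2) ≤ 1 + 1 / 4000 ∧ dist (p q.1) (p q.2) ≤ 1 + 1 / 4000}.ncard = 2) → ∃ σ : Fin 12 → Fin 12 → Fin 12, (∀ v a : Fin 12, a ≠ v → dist (p v) (p a) ≤ 1 + 1 / 4000 → (σ v a ≠ v ∧ σ v a ≠ a ∧ dist (p v) (p (σ v a)) ≤ 1 + 1 / 4000)) ∧ (∀ v a b : Fin 12, a ≠ v → b ≠ v → dist (p v) (p a) ≤ 1 + 1 / 4000 → dist (p v) (p b) ≤ 1 + 1 / 4000 → σ v a = σ v b → a = b) ∧ (∀ v a : Fin 12, a ≠ v → dist (p v) (p a) ≤ 1 + 1 / 4000 → (σ v (σ v a) ≠ a ∧ σ v (σ v (σ v (σ v a))) = a)) ∧ (∀ v : Fin 12, {a : Fin 12 | a ≠ v ∧ dist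 (p v) (p a) ≤ 1 + 1 / 4000 ∧ dist (p a) (p (σ v a)) ≤ 1 + 1 / 4000}.ncard = 2) ∧ (∀ v a : Fin 12, a ≠ v → dist (p v) (p a) ≤ 1 + 1 / 4000 → dist (p a) (p (σ v a)) ≤ 1 + 1 / 4000 → (σ a (σ v a) = v ∧ σ (σ v a) v = a)) ∧ (∀ v a : Fin 12, a ≠ v → dist (p v) (p a) ≤ 1 + 1 / 4000 → ¬ dist (p a) (p (σ v a)) ≤ 1 + 1 / 4000 → ∃ w : Fin 12, w ≠ a ∧ w ≠ σ v a ∧ dist (p a) (p w) ≤ 1 + 1 / 4000 ∧ σ a w = v ∧ dist (p w) (p (σ v a)) ≤ 1 + 1 / 4000 ∧ σ (σ v a) v = w ∧ σ w (σ v a) = a)) → (∀ (A : Fin 12 → Fin 12 → Bool) (σ : Fin 12 → Fin 12 → Fin 12), (∀ i : Fin 12, A i i = false) → (∀ i j : Fin 12, A i j = A j i) → (∀ i : Fin 12, (Finset.univ.filter (fun j : Fin 12 => A i j = true)).card = 4) → (∀ v a : Fin 12, A v a = true → (A v (σ v a) = true ∧ σ v a ≠ a)) → (∀ v a b : Fin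 12, A v a = true → A v b = true → σ v a = σ v b → a = b) → (∀ v a : Fin 12, A v a = true → (σ v (σ v a) ≠ a ∧ σ v (σ v (σ v (σ v a))) = a)) → (∀ v : Fin 12, (Finset.univ.filter (fun a : Fin 12 => A v a = true ∧ A a (σ v a) = true)).card = 2) → (∀ v a : Fin 12, A v a = true → A a (σ v a) = true → (σ a (σ v a) = v ∧ σ (σ v a) v = a)) → (∀ v a : Fin 12, A v a = true → A a (σ v a) = false → ∃ w : Fin 12, A a w = true ∧ σ a w = v ∧ A w (σ v a) = true ∧ σ (σ v a) v = w ∧ σ w (σ v a) = a) → (∃ e : Fin 12 ≃ {q : EuclideanSpace ℝ (Fin 3) // q ∈ Literature.Geometry.DiscreteGeometry.fccKissingPattern}, ∀ i j : Fin 12, i ≠ j → (A i j = true ↔ dist (e i).1 (e j).1 = 1)) ∨ (∃ e : Fin 12 ≃ {q : EuclideanSpace ℝ (Fin 3) // q ∈ Literature.Geometry.DiscreteGeometry.hcpKissingPattern}, ∀ i j : Fin 12, i ≠ j → (A i j = true ↔ dist (e i).1 (e j).1 = 1))) → ∀ (S : Set (EuclideanSpace ℝ (Fin 3))) (u : EuclideanSpace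 ℝ (Fin 3)), u ∈ S → (∀ v ∈ S, dist u v ≤ 1 + 1 / 4000 → ((∀ w ∈ S, w ≠ v → 1 - 1 / 4000 ≤ dist v w ∧ (dist v w ≤ 1 + 1 / 4000 ∨ 7 / 5 ≤ dist v w)) ∧ {w ∈ S | w ≠ v ∧ dist v w ≤ 1 + 1 / 4000}.ncard = 12)) → ((∃ e : {w : EuclideanSpace ℝ (Fin 3) // w ∈ S ∧ w ≠ u ∧ dist u w ≤ 1 + 1 / 400} ≃ {q : EuclideanSpace ℝ (Fin 3) // q ∈ Literature.Geometry.DiscreteGeometry.fccKissingPattern}, ∀ w w' : {w : EuclideanSpace ℝ (Fin 3) // w ∈ S ∧ w ≠ u ∧ dist u w ≤ 1 + 1 / 400}, w ≠ w' → (dist w.1 w'.1 ≤ 1 + 1 / 400 ↔ dist (e w).1 (e w').1 = 1)) ∨ (∃ e : {w : EuclideanSpace ℝ (Fin 3) // w ∈ S ∧ w ≠ u ∧ dist u w ≤ 1 + 1 / 400} ≃ {q : EuclideanSpace ℝ (Fin 3) // q ∈ Literature.Geometry.DiscreteGeometry.hcpKissingPattern}, ∀ w w' : {w : EuclideanSpace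 ℝ (Fin 3) // w ∈ S ∧ w ≠ u ∧ dist u w ≤ 1 + 1 / 400}, w ≠ w' → (dist w.1 w'.1 ≤ 1 + 1 / 400 ↔ dist (e w).1 (e w').1 = 1))) := by
  intro hK1 hK2 hK3 hK4 S u hu hH
  have hu' := hH u hu (by rw [dist_self]; norm_num)
  -- the `1/400`-soft shell of `u` is its `1/4000`-soft shell
  have hset : {w ∈ S | w ≠ u ∧ dist u w ≤ 1 + 1 / 400} = {w ∈ S | w ≠ u ∧ dist u w ≤ 1 + 1 / 4000} := by
    ext w
    simp only [Set.mem_setOf_eq]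
    constructor
    · rintro ⟨hw, hwu, hd⟩
      refine ⟨hw, hwu, ?_⟩
      rcases (hu'.1 w hw hwu).2 with h | h
      · exact h
      · exfalso; linarith
    · rintro ⟨hw, hwu, hd⟩
      exact ⟨hw, hwu, by linarith⟩
  have hcard : {w ∈ S | w ≠ u ∧ dist u w ≤ 1 + 1 / 400}.ncard = 12 := by rw [hset]; exact hu'.2
  have hN : Nat.card {w : EuclideanSpace ℝ (Fin 3) // w ∈ S ∧ w ≠ u ∧ dist u w ≤ 1 + 1 / 400} = 12 := hcard
  haveI : Finite {w : EuclideanSpace ℝ (Fin 3) // w ∈ S ∧ w ≠ u ∧ dist u w ≤ 1 + 1 / 400} :=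
    Nat.finite_of_card_ne_zero (by rw [hN]; norm_num)
  obtain ⟨eN⟩ : Nonempty ({w : EuclideanSpace ℝ (Fin 3) // w ∈ S ∧ w ≠ u ∧ dist u w ≤ 1 + 1 / 400} ≃ Fin 12) :=
    ⟨(Finite.equivFin _).trans (finCongr hN)⟩
  set p : Fin 12 → EuclideanSpace ℝ (Fin 3) := fun i => (eN.symm i).1 with hp
  have hmem : ∀ i, p i ∈ S ∧ p i ≠ u ∧ dist u (p i) ≤ 1 + 1 / 400 := fun i => (eN.symm i).2
  have hmem' : ∀ i, dist u (p i) ≤ 1 + 1 / 4000 := fun i => by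
    rcases (hu'.1 (p i) (hmem i).1 (hmem i).2.1).2 with h | h
    · exact h
    · exfalso; linarith [(hmem i).2.2]
  have hR : ∀ i : Fin 12, 1 - 1 / 4000 ≤ dist u (p i) ∧ dist u (p i) ≤ 1 + 1 / 4000 := fun i =>
    ⟨(hu'.1 (p i) (hmem i).1 (hmem i).2.1).1, hmem' i⟩
  have hinj : ∀ i j : Fin 12, i ≠ j → p i ≠ p j := by
    intro i j hij h
    exact hij (eN.symm.injective (Subtype.ext h))
  have hP : ∀ i j : Fin 12, i ≠ j → 1 - 1 / 4000 ≤ dist (p i) (p j) ∧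
      (dist (p i) (p j) ≤ 1 + 1 / 4000 ∨ 7 / 5 ≤ dist (p i) (p j)) := by
    intro i j hij
    exact (hH (p i) (hmem i).1 (hmem' i)).1 (p j) (hmem j).1 (hinj j i (Ne.symm hij))
  have h4 := hK1 u p hR hP
  have hcen := hK2 u p hR hP h4
  obtain ⟨σ, hσ1, hσ2, hσ3, hσC3, hσ4a, hσ4b⟩ := hK3 u p hR hP hcen
  -- the abstract data
  set A : Fin 12 → Fin 12 → Bool := fun i j => decide (j ≠ i ∧ dist (p i) (p j) ≤ 1 + 1 / 4000) with hA
  have hAiff : ∀ i j : Fin 12, A i j = true ↔ (j ≠ i ∧ dist (p i) (p j) ≤ 1 + 1 / 4000) := fun i j => by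
    simp only [hA, decide_eq_true_eq]
  have hAff : ∀ i j : Fin 12, A i j = false ↔ ¬ (j ≠ i ∧ dist (p i) (p j) ≤ 1 + 1 / 4000) := fun i j => by
    rw [← hAiff, Bool.not_eq_true]
  have x1 : ∀ i : Fin 12, A i i = false := fun i => by
    rw [hAff]; exact fun h => h.1 rfl
  have x2 : ∀ i j : Fin 12, A i j = A j i := fun i j => by
    rw [Bool.eq_iff_iff, hAiff, hAiff, dist_comm (p i) (p j)]
    exact ⟨fun h => ⟨Ne.symm h.1, h.2⟩, fun h => ⟨Ne.symm h.1, h.2⟩⟩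
  have x3 : ∀ i : Fin 12, (Finset.univ.filter (fun j : Fin 12 => A i j = true)).card = 4 := by
    intro i
    have hs : ({j : Fin 12 | j ≠ i ∧ dist (p i) (p j) ≤ 1 + 1 / 4000} : Set (Fin 12)) =
        ↑(Finset.univ.filter (fun j : Fin 12 => A i j = true)) := by
      ext j
      simp only [Set.mem_setOf_eq, Finset.coe_filter, Finset.mem_univ, true_and, hAiff]
    rw [← Set.ncard_coe_finset, ← hs]
    exact (hcen i).1
  have x4 : ∀ v a : Fin 12, A v a = true → (A v (σ v a) = true ∧ σ v a ≠ a) := by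
    intro v a h
    rw [hAiff] at h
    obtain ⟨h1, h2, h3⟩ := hσ1 v a h.1 h.2
    exact ⟨(hAiff _ _).2 ⟨h1, h3⟩, h2⟩
  have x5 : ∀ v a b : Fin 12, A v a = true → A v b = true → σ v a = σ v b → a = b := by
    intro v a b ha hb hab
    rw [hAiff] at ha hb
    exact hσ2 v a b ha.1 hb.1 ha.2 hb.2 hab
  have x6 : ∀ v a : Fin 12, A v a = true → (σ v (σ v a) ≠ a ∧ σ v (σ v (σ v (σ v a))) = a) := by
    intro v a h
    rw [hAiff] at h
    exact hσ3 v a h.1 h.2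
  have x7 : ∀ v : Fin 12, (Finset.univ.filter (fun a : Fin 12 => A v a = true ∧ A a (σ v a) = true)).card = 2 := by
    intro v
    have hs : ({a : Fin 12 | a ≠ v ∧ dist (p v) (p a) ≤ 1 + 1 / 4000 ∧ dist (p a) (p (σ v a)) ≤ 1 + 1 / 4000} : Set (Fin 12)) =
        ↑(Finset.univ.filter (fun a : Fin 12 => A v a = true ∧ A a (σ v a) = true)) := by
      ext a
      simp only [Set.mem_setOf_eq, Finset.coe_filter, Finset.mem_univ, true_and, hAiff]
      constructor
      · rintro ⟨h1, h2, h3⟩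
        exact ⟨⟨h1, h2⟩, (hσ1 v a h1 h2).2.1, h3⟩
      · rintro ⟨⟨h1, h2⟩, -, h3⟩
        exact ⟨h1, h2, h3⟩
    rw [← Set.ncard_coe_finset, ← hs]
    exact hσC3 v
  have x8 : ∀ v a : Fin 12, A v a = true → A a (σ v a) = true → (σ a (σ v a) = v ∧ σ (σ v a) v = a) := by
    intro v a h h'
    rw [hAiff] at h h'
    exact hσ4a v a h.1 h.2 h'.2
  have x9 : ∀ v a : Fin 12, A v a = true → A a (σ v a) = false → ∃ w : Fin 12, A a w = true ∧ σ a w = v ∧ A w (σ v a) = true ∧ σ (σ v a) v = w ∧ σ w (σ v a) = a := by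
    intro v a h h'
    rw [hAiff] at h
    rw [hAff] at h'
    have hne : σ v a ≠ a := (hσ1 v a h.1 h.2).2.1
    have hnd : ¬ dist (p a) (p (σ v a)) ≤ 1 + 1 / 4000 := fun hd => h' ⟨hne, hd⟩
    obtain ⟨w, hwa, hwb, hdaw, hsaw, hdwb, hsbv, hswb⟩ := hσ4b v a h.1 h.2 hnd
    exact ⟨w, (hAiff _ _).2 ⟨hwa, hdaw⟩, hsaw, (hAiff _ _).2 ⟨hwb.symm, hdwb⟩, hsbv, hswb⟩
  -- the value of `p` on an indexed neighbour, and the dichotomy on the shell type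
  have hpe : ∀ w : {w : EuclideanSpace ℝ (Fin 3) // w ∈ S ∧ w ≠ u ∧ dist u w ≤ 1 + 1 / 400}, p (eN w) = w.1 := by
    intro w
    simp only [hp, Equiv.symm_apply_apply]
  have hdich : ∀ w w' : {w : EuclideanSpace ℝ (Fin 3) // w ∈ S ∧ w ≠ u ∧ dist u w ≤ 1 + 1 / 400}, w ≠ w' →
      (dist w.1 w'.1 ≤ 1 + 1 / 400 ↔ (eN w' ≠ eN w ∧ dist (p (eN w)) (p (eN w')) ≤ 1 + 1 / 4000)) := by
    intro w w' hne
    have hij : eN w ≠ eN w' := fun h => hne (eN.injective h)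
    rw [hpe w, hpe w']
    constructor
    · intro hd
      refine ⟨hij.symm, ?_⟩
      have := (hP (eN w) (eN w') hij).2
      rw [hpe w, hpe w'] at this
      rcases this with h | h
      · exact h
      · exfalso; linarith
    · rintro ⟨-, hd⟩
      linarith
  rcases hK4 A σ x1 x2 x3 x4 x5 x6 x7 x8 x9 with ⟨e, he⟩ | ⟨e, he⟩
  · refine Or.inl ⟨eN.trans e, fun w w' hne => ?_⟩
    have hij : eN w ≠ eN w' := fun h => hne (eN.injective h)
    rw [hdich w w' hne, ← hAiff, he (eN w) (eN w') hij]
    simp only [Equiv.trans_apply]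
  · refine Or.inr ⟨eN.trans e, fun w w' hne => ?_⟩
    have hij : eN w ≠ eN w' := fun h => hne (eN.injective h)
    rw [hdich w w' hne, ← hAiff, he (eN w) (eN w') hij]
    simp only [Equiv.trans_apply]

/-- **THE KERNEL** (one-shell effective local Hales at tolerance `1/4000`, gap `7/5`), from the four
registered stubs K1–K4 through `kernel_of_stubs`. -/
theorem localHalesKernel75 : ∀ (S : Set (EuclideanSpace ℝ (Fin 3))) (u : EuclideanSpace ℝ (Fin 3)), u ∈ S → (∀ v ∈ S, dist u v ≤ 1 + 1 / 4000 → ((∀ w ∈ S, w ≠ v → 1 - 1 / 4000 ≤ dist v w ∧ (dist v w ≤ 1 + 1 / 4000 ∨ 7 / 5 ≤ dist v w)) ∧ {w ∈ S | w ≠ v ∧ dist v w ≤ 1 + 1 / 4000}.ncard = 12)) → ((∃ e : {w : EuclideanSpace ℝ (Fin 3) // w ∈ S ∧ w ≠ u ∧ dist u w ≤ 1 + 1 / 400} ≃ {q : EuclideanSpace ℝ (Fin 3) // q ∈ Literature.Geometry.DiscreteGeometry.fccKissingPattern}, ∀ w w' : {w : EuclideanSpace ℝ (Fin 3) // w ∈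 S ∧ w ≠ u ∧ dist u w ≤ 1 + 1 / 400}, w ≠ w' → (dist w.1 w'.1 ≤ 1 + 1 / 400 ↔ dist (e w).1 (e w').1 = 1)) ∨ (∃ e : {w : EuclideanSpace ℝ (Fin 3) // w ∈ S ∧ w ≠ u ∧ dist u w ≤ 1 + 1 / 400} ≃ {q : EuclideanSpace ℝ (Fin 3) // q ∈ Literature.Geometry.DiscreteGeometry.hcpKissingPattern}, ∀ w w' : {w : EuclideanSpace ℝ (Fin 3) // w ∈ S ∧ w ≠ u ∧ dist u w ≤ 1 + 1 / 400}, w ≠ w' → (dist w.1 w'.1 ≤ 1 + 1 / 400 ↔ dist (e w).1 (e w').1 = 1))) :=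
  kernel_of_stubs75 stub_softDegreeLeFour
    (fun u p hR hP h4 => stub_censusCore stub_censusFrame (stub_censusContain stub_censusCert) u p hR hP h4)
    stub_localStructure stub_combClassification

end Summit.AtomisticToContinuum.Crystallization.Theorems.ZeroDefectDensityBirth

end
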